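import Summits.QuantumFields.BalabanUV.Beta.GAN24.BornLambdaRowHolds
import Summits.QuantumFields.BalabanUV.Beta.GAN24.BornLambdaContactBound

/-!
# `BalabanUV.Beta.GAN24.BornLambdaSectorRowHolds` — binder row G-an2-4 / (CONV-C), S-slot, F16-S road (B), BORNSEC-PLAN v1.1 (C6):
# **THE Λ-BORN ROW `hB(0, cΛ)` OF THE `d = 3` COMB FAMILY HOLDS, UNCONDITIONALLY** — the row owner's one-letter socket fed with leaf-02's (C4) contact letter

NOT IN PRINT; OUR PROOF (a one-line [folklore] junction over tree theorems BY NAME; nothing of Bałaban's is re-derived here).  HONEST FRAMING (cell contract,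
verbatim): «discharging `BetaPertH` makes Bałaban's UV stability UNCONDITIONAL — a real constructive-QFT result; it is NOT the continuum limit and NOT the Clay
problem.»  HONEST DEPENDENCY (verbatim): «continuum YM on T⁴ ⇐ BetaPertH ∧ nine spine estimates (0/9 proved); BetaPertH ⇐ (D1) ∧ (D4) ∧ CAP+tail; G-an2-4 gates
asym, D1 and NE2/3/4.»

WHAT.  The row owner gan24-p1 g21's `BornLambdaRowHolds.exists_hBLam_three_of_contact_poly` (p300788 ✓; the undressed Λ row discharged there from the three rooted
road-S3 rows (ρ-a)…(ρ-d)) reduces the Λ-born row `hB(0, cΛ)` of the comb family (E) — `LocStencil (unitS (sfStep Lc k) (smStep 3 Lc k) (bornSecAt Lc ρ cE 0 cΛ k)) C δ`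
uniformly in the level `k` and the in-block root `ρ = toSite rr` — to ONE letter, the per-lineage poly-geometric contact letter `hCg`; leaf-02 g49's (C4) END
`BornLambdaContactBound.exists_hCg_three` (p300264 ✓) IS that letter at `p = 1` under `|cE| ≤ Lc^4`, which the pin `cE = Lc^4` satisfies.  Hence
**`exists_hBLam_three (hLc : 2 ≤ Lc) (hcE : cE = (Lc:ℝ)^(3+1)) (cΛ : ℝ)`** with NO further hypothesis.  (The owner's W18, HOME/CLAIMS.log 2026-08-21 l.35256: «ONE theorem
`exists_hBLam_three : hB(0,cΛ)` hypothesis-free — first refusal leaf-02 g49, leaf-04 second»; leaf-02 g49 closed l.35302 leaving (C6) to the owner's word.)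
0 `def`, 0 cited facts, 0 `def … : Prop`, 0 sorry.  Discharges the Λ HALF of hB for family (E) ONLY; NOT the V half (`hB(cVH, 0)` ⇐ the V contact letter `hCgV`, (V-C)),
NOT hB, NOT hS0 of `SrecAt`, NOT hS0 ∕ hSall0 at `JsB12Sym0`, NOT (hS, hSall); NEVER «G-an2-4 closed»; NOT (CONV-C) as typed, NOT D1, NOT BetaPertH, NOT continuum,
NOT Clay.  Typed by `b2b-balaban-gan24-formalise-leaf-04` gen 56 on the owner's W18.
-/

noncomputable section

open Literature.MathematicalPhysics.QuantumFieldTheory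
open Literature.MathematicalPhysics.QuantumFieldTheory.Balaban1983to89
open Literature.MathematicalPhysics.QuantumFieldTheory.Balaban1983to89.Beta
open AffineAveraging (box toSite)
open OneStepResolventKernel (LocStencil)
open Summit.QuantumFields.BalabanUV.Beta.HessKerDressedUnits (unitS)
open Summit.QuantumFields.BalabanUV.Beta.GAN24.CombesThomas (sfStep smStep)
open Summit.QuantumFields.BalabanUV.Beta.GAN24.SrecWilsonSector (bornSecAt)
open Summit.QuantumFields.BalabanUV.Beta.GAN24.BornLambdaRowHolds (exists_hBLam_three_of_contact_poly)
open Summit.QuantumFields.BalabanUV.Beta.GAN24.BornLambdaContactBound (exists_hCg_three)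

namespace Summit.QuantumFields.BalabanUV.Beta.GAN24.BornLambdaSectorRowHolds

variable {Lc : ℕ} [NeZero Lc]

/-- NOT IN PRINT; OUR PROOF ([folklore] junction; UNCONDITIONAL).  **THE Λ-BORN ROW `hB(0, cΛ)` OF THE `d = 3` COMB FAMILY HOLDS**: at the pin `cE = Lc^4`, for every
`Lc ≥ 2` and every `cΛ`, there are `C` and `δ > 0` such that for every in-block root `rr ∈ box 4 Lc` and every level `k` the unit-rescaled Born-Λ sector
`unitS (sfStep Lc k) (smStep 3 Lc k) (bornSecAt Lc (toSite rr) cE 0 cΛ k)` is a local stencil family with constant `C` at rate `δ` — the owner's one-letter socket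
`exists_hBLam_three_of_contact_poly` at `p = 1` fed with leaf-02's contact letter `exists_hCg_three` (its side condition `|cE| ≤ Lc^4` read off the pin). -/
theorem exists_hBLam_three (hLc : 2 ≤ Lc) {cE : ℝ} (hcE : cE = (Lc : ℝ) ^ (3 + 1)) (cΛ : ℝ) :
    ∃ C δ : ℝ, 0 < δ ∧ ∀ (rr : Fin (3 + 1) → ℕ), rr ∈ box (3 + 1) Lc →
      ∀ k : ℕ, LocStencil (unitS (sfStep Lc k) (smStep 3 Lc k) (bornSecAt Lc (toSite rr) cE 0 cΛ k)) C δ :=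
  exists_hBLam_three_of_contact_poly hLc hcE cΛ 1 (exists_hCg_three hLc cE cΛ (by rw [hcE, abs_of_nonneg (by positivity)]))

end Summit.QuantumFields.BalabanUV.Beta.GAN24.BornLambdaSectorRowHolds

end
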